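import Summits.QuantumFields.YangMills.Theorems.BalabanUVNodesN19OtherKindsU5b

/-!
# BalabanUVNodes ∕ N19 ledger link, SYNCHRONISED — «Link S R» typed as the NON-EDGE binder list of the gen-2 knit chain
# (`BalabanUVNodesN19OtherKindsU5b.core_summable_of_nodes_u5b`): NO hazard-H-U5b-1 field; instead the (2.25) structure a spine
# record actually carries (seat dag-n19-a gen 2; STAGED companion of [DAGN19A-G2-LINK-DESIGN-1]; count-neutral; Track A node N19,
# cluster K5 «SpineMatching»; companion of dag-n19-b's `BalabanUVNodesN19LedgerLink` (`LedgerAt`, binder list of the knits v1 ∕ v1′))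

HONEST FRAMING.  NE7 is NOT PRINTED and NOT proved.  This file defines ONE data bundle `LedgerDataSync` and ONE `Prop`-valued
predicate `LedgerAtSync` = EXACTLY the binders of `N19OtherKindsU5b.core_summable_of_nodes_u5b` (p413531) that are NEITHER an
in-edge statement of record (N16 `NE3Shape` ∕ N17 via node U2's output ∕ N18 `NE5` ∕ N22 `NE9 ∧ FadingMemory`) NOR the printed-grade
argument bracket (T) NOR the window memberships: the synchronised two-run TERM FORMAT (pending positive integrals of the common
(2.25)-ledger), a τ-free REFERENCE LEDGER with the (0.26) multiplicity, the BOOKING of the good class (`RecentOnly` on the log window),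
the other kinds FACTORED as extracted constants × main-action readings × the recent node-U5b ledger (boundary ∕ 𝐑 ∕ insert ∕ pending
pieces, `T4RecentScale.FactorLogRatio`) × the remaining kinds `o″` with their class-constant centre clause (O‴), the ZERO-CENTRED
one-run size in the (2.43) log-window profile, the letter signs, the rate ordering, and `C.transport oneB = oneA`.  Compared with
`LedgerAt`: its field `dev` (hazard H-U5b-1 for every `Cr ≥ 0`) is ABSENT — in the gen-2 chain H-U5b-1 is a THEOREM by name from
N17 · N18 · N22 + `hone` + the booking (`N19CentreSync`, `N19ConstantsWindow`) —, `κ₁` is gone (size zero-centred), `sc`∕`mult` are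
DERIVED from the reference ledger, and `other` is split into the U5b ledger + (O‴).  Every field is a HYPOTHESIS SHAPE about Bałaban's
two-run (2.18) ledger at the carriers of record (cell NODE O; no tree object); nothing is asserted.  `core_summable_of_ledgerAtSync` is
the N19 edge in node U2's OUTPUT letter — ONE line over p413531.  One fixed finite torus, rung (B)+1; NOT infinite volume, NOT a mass
gap, NOT Clay.  Definitions only + one theorem; 0 sorry; standard axioms.

CITATION HEADER (LOCATIONS only).  [Balaban1988Convergent] (2.25)–(2.27) p. 259, (2.30)–(2.31) p. 260, (2.40)–(2.42) p. 261, p. 262,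
Thm 2 (2.43) p. 263; [Balaban1987RG1] (0.26) p. 257; [Balaban1989LargeFieldII] p. 380, (1.98)–(1.101) p. 390 — as quoted in the tree's
`T4RecentScale` ∕ `T4GoodClassBudget` ∕ `T4TermwiseBudget` docstrings; used ONLY as shapes of hypotheses.
-/

open Finset MeasureTheory

namespace Summit.QuantumFields.YangMills.BalabanUVNodes.N19LedgerLinkSync

open Literature.MathematicalPhysics.QuantumFieldTheory.Balaban1983to89
open T4OutputRate T4RecentScale T4GoodClassBudget T4CauchySum T4TowerRateComposition T4TowerRateDischarge
open T4EtaRateMin (Readings NE3Shape)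
open T4RateLiaison (GaugeDominated)
open Summit.QuantumFields.BalabanUV.T4Continuum.Spine
open Summit.QuantumFields.YangMills.BalabanUVNodes.N19OtherKindsU5b (core_summable_of_nodes_u5b)

/-! ## §1 The ledger DATA a spine record supplies beyond the spine carriers and the rate carriers (synchronised form) -/

/-- **LEDGER DATA, SYNCHRONISED FORM** of one loop string along one tuned run: the common fluctuation measures `μ`, the (2.25)
E-ledger `fac` and the τ-free reference ledger `All`, the reference backgrounds `oneA oneB`, the FULL other kinds `oA oB` and their
factorisation data — the recent node-U5b ledger (`facO`, kinds `kindO`, scales `scO`, weights `wO`, factors `ofA ofB`, constants `cf`,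
kind constant `CO`, constants' rate `Cs`) and the remaining kinds `oA″ oB″` with centre `cO″`, radius `RO″ ≤ vol·rO″` —, the
zero-centred one-run size radii `S`, the multiplicity constant `Cw` and base `Λg`, the size letters `E₀ m a`, the log-window constant
`Cl`, and the common rate `θ′`.  Nothing of Bałaban's is constructed. [folklore] (a definition of a data bundle; no estimate) -/
structure LedgerDataSync (C : Carriers) (F : Type*) (ι : Type) [MeasurableSpace ι] (σ : Type*) where
  /-- common fluctuation measure of the good term `τ` at cutoff `K`, source `t` -/
  μ : ℕ → ℝ → σ → Measure ι
  /-- the (2.25)-ledger of matched E-factor domains of the term, and the τ-free reference ledger of cutoff `K` -/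
  fac : ℕ → ℝ → σ → Finset C.Dom
  All : ℕ → Finset C.Dom
  /-- reference backgrounds of the vacuum-energy subtraction, run A ∕ run B -/
  oneA : C.BgA
  oneB : C.BgB
  /-- the full other kinds, run A ∕ run B -/
  oA : ℕ → ℝ → σ → ι → ℝ
  oB : ℕ → ℝ → σ → ι → ℝ
  /-- the recent node-U5b ledger of other kinds: index sets, kinds, scales, weights, factors, constants, kind constant, constants' rate -/
  facO : ℕ → ℝ → σ → Finset F
  kindO : F → Kind
  scO : F → ℕ
  wO : F → ℝ
  ofA : ℕ → ℝ → σ → F → ι → ℝ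
  ofB : ℕ → ℝ → σ → F → ι → ℝ
  cf : ℕ → ℝ → σ → F → ℝ
  CO : ℝ
  Cs : ℝ
  /-- the remaining kinds and their centre ∕ radius ∕ per-unit-volume radius profile -/
  oA'' : ℕ → ℝ → σ → ι → ℝ
  oB'' : ℕ → ℝ → σ → ι → ℝ
  cO'' : ℕ → ℝ → σ → ℝ
  RO'' : ℕ → ℝ → σ → ℝ
  rO'' : ℕ → ℝ
  /-- zero-centred one-run size radii per creation-scale slice -/
  S : ℕ → ℝ → σ → ℕ → ℝ
  /-- multiplicity constant and base; size letters of the (2.43) window profile; log-window constant; the common rate -/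
  Cw : ℝ
  Λg : ℝ
  E₀ : ℝ
  m : ℕ
  a : ℝ
  Cl : ℝ
  θ' : ℝ

/-! ## §2 «Link S R», synchronised — the LEDGER PREDICATE without a hazard-H-U5b-1 field -/

/-- **`LedgerAtSync`** — the synchronised two-run LEDGER PREDICATE linking the spine carriers (`l₀ vol T Bad` and the good-class cores
`A B`) to the rate carriers of the in-edges (`C EA EB κ`, the re-indexed coupling tables `g`, NE3's reading family `R` with the background
maps `uA uB`, the rate letters `ω θc θ₅ θ₃`): EXACTLY the non-edge binders of `N19OtherKindsU5b.core_summable_of_nodes_u5b` — term format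
(`fmtA fmtB int off`), reference ledger (`all_sub all_sc all_mult`), booking (`recent`, `Cl_nonneg`), the other kinds' factorisation
(`ofmtA ofmtB`), node U5b on the recent ledger (`u5b wO_nonneg orec omult cf_le CO_nonneg Cs_nonneg`), the remaining kinds (`posO rvol
other RO_le rO_summable cO_dev`), zero-centred size in the (2.43)-window profile (`size sizeProfile` + letter signs), the rate ordering
(`rate_gt θ₅_le θ₃_le rate_lt_one rate_le_base one_le_base`), and `one : C.transport oneB = oneA`.  A HYPOTHESIS SHAPE (cell NODE O);
nothing asserted; NO field states hazard H-U5b-1. [folklore] -/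
structure LedgerAtSync {C : Carriers} [DecidableEq C.Dom] {F : Type*} {ι X : Type} [MeasurableSpace ι] {σ : Type*} [DecidableEq σ]
    (L : LedgerDataSync C F ι σ) (l₀ vol : ℝ) (T : ℕ → Finset σ) (Bad : ℕ → ℝ → Finset σ) (A B : ℕ → ℝ → σ → ℝ)
    (R : Readings ι X) (EA : Functional C C.BgA) (EB : Functional C C.BgB) (κ : ℝ) (g : ℕ → ℕ → ℝ)
    (uA : ℕ → ι → C.BgA) (uB : ℕ → ι → C.BgB) (ω θc θ₅ θ₃ : ℝ) : Prop where
  fmtA : ∀ K t τ, A K t τ = ∫ v, (∏ X ∈ L.fac K t τ,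
    Real.exp (EA (g K) (uA K v) X - EA (g K) L.oneA X)) * L.oA K t τ v ∂(L.μ K t τ)
  fmtB : ∀ K t τ, B K t τ = ∫ v, (∏ X ∈ L.fac K t τ,
    Real.exp (EB (fun i => g (K + 1) (i + 1)) (uB K v) X - EB (fun i => g (K + 1) (i + 1)) L.oneB X)) *
      L.oB K t τ v ∂(L.μ K t τ)
  int : ∀ K t, |t| ≤ l₀ → ∀ τ ∈ T K \ Bad K t,
    Integrable (fun v => (∏ X ∈ L.fac K t τ, Real.exp (EA (g K) (uA K v) X - EA (g K) L.oneA X)) *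
      L.oA K t τ v) (L.μ K t τ) ∧
    Integrable (fun v => (∏ X ∈ L.fac K t τ,
      Real.exp (EB (fun i => g (K + 1) (i + 1)) (uB K v) X - EB (fun i => g (K + 1) (i + 1)) L.oneB X)) *
      L.oB K t τ v) (L.μ K t τ)
  off : ∀ K t, |t| ≤ l₀ → ∀ τ ∈ T K \ Bad K t, ∀ v, v ∉ R.dom →
    (∏ X ∈ L.fac K t τ, Real.exp (EA (g K) (uA K v) X - EA (g K) L.oneA X)) * L.oA K t τ v = 0 ∧
    (∏ X ∈ L.fac K t τ,
      Real.exp (EB (fun i => g (K + 1) (i + 1)) (uB K v) X - EB (fun i => g (K + 1) (i + 1)) L.oneB X)) *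
      L.oB K t τ v = 0
  all_sub : ∀ K t, |t| ≤ l₀ → ∀ τ ∈ T K \ Bad K t, L.fac K t τ ⊆ L.All K
  all_sc : ∀ K, ∀ X ∈ L.All K, C.scale X ≤ K
  all_mult : ∀ K, Multiplicity (L.All K) C.scale (fun X => Real.exp (-(κ * C.d X))) L.Cw vol L.Λg K
  Cl_nonneg : 0 ≤ L.Cl
  recent : ∀ K t, |t| ≤ l₀ → ∀ τ ∈ T K \ Bad K t, RecentOnly (L.All K \ L.fac K t τ) C.scale (jlogOf L.Cl K) K
  ofmtA : ∀ K t τ v, L.oA K t τ v = Real.exp (∑ X ∈ L.fac K t τ, EA (g K) L.oneA X) *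
    (Real.exp (-(R.act K v)) * ((∏ i ∈ L.facO K t τ, L.ofA K t τ i v) * L.oA'' K t τ v))
  ofmtB : ∀ K t τ v, L.oB K t τ v = Real.exp (∑ X ∈ L.fac K t τ, EB (fun i => g (K + 1) (i + 1)) L.oneB X) *
    (Real.exp (-(R.act (K + 1) v)) * ((∏ i ∈ L.facO K t τ, L.ofB K t τ i v) * L.oB'' K t τ v))
  u5b : ∀ K t, |t| ≤ l₀ → ∀ τ ∈ T K \ Bad K t,
    FactorLogRatio R.dom (L.facO K t τ) L.kindO L.scO L.wO (L.ofA K t τ) (L.ofB K t τ) (L.cf K t τ)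
      (fun _ => L.CO) L.θ' (fun _ => 0)
  CO_nonneg : 0 ≤ L.CO
  wO_nonneg : ∀ i, 0 ≤ L.wO i
  orec : ∀ K t, |t| ≤ l₀ → ∀ τ ∈ T K \ Bad K t, RecentOnly (L.facO K t τ) L.scO (jlogOf L.Cl K) K
  omult : ∀ K t, |t| ≤ l₀ → ∀ τ ∈ T K \ Bad K t,
    WindowMultiplicity (L.facO K t τ) L.scO L.wO L.Cw vol L.Λg (jlogOf L.Cl K) K
  cf_le : ∀ K t, |t| ≤ l₀ → ∀ τ ∈ T K \ Bad K t, ∀ i ∈ L.facO K t τ, |L.cf K t τ i| ≤ L.Cs * L.θ' ^ L.scO i * L.wO i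
  Cs_nonneg : 0 ≤ L.Cs
  posO : ∀ K t, |t| ≤ l₀ → ∀ τ ∈ T K \ Bad K t, ∀ v ∈ R.dom, 0 < L.oA'' K t τ v ∧ 0 < L.oB'' K t τ v
  rvol : R.vol ≤ vol
  size : ∀ K t, |t| ≤ l₀ → ∀ τ ∈ T K \ Bad K t, ∀ v ∈ R.dom, ∀ j ≤ K,
    |∑ X ∈ L.fac K t τ with C.scale X = j,
        (Real.log (Real.exp (EB (fun i => g (K + 1) (i + 1)) (uB K v) X
            - EB (fun i => g (K + 1) (i + 1)) L.oneB X))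
          - Real.log (Real.exp (EA (g K) (uA K v) X - EA (g K) L.oneA X)))| ≤ L.S K t τ j
  vol_nonneg : 0 ≤ vol
  E₀_nonneg : 0 ≤ L.E₀
  a_pos : 0 < L.a
  a_lt_one : L.a < 1
  sizeProfile : ∀ K t, |t| ≤ l₀ → ∀ τ ∈ T K \ Bad K t, ∀ j ≤ K,
    L.S K t τ j ≤ vol * (L.E₀ * ((K : ℝ) + 1) ^ L.m * L.a ^ (K - j))
  other : ∀ K t, |t| ≤ l₀ → ∀ τ ∈ T K \ Bad K t, ∀ v ∈ R.dom,
    |Real.log (L.oB'' K t τ v) - Real.log (L.oA'' K t τ v) - L.cO'' K t τ| ≤ L.RO'' K t τ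
  RO_le : ∀ K t, |t| ≤ l₀ → ∀ τ ∈ T K \ Bad K t, L.RO'' K t τ ≤ vol * L.rO'' K
  rO_summable : Summable L.rO''
  one : C.transport L.oneB = L.oneA
  cO_dev : ∃ c₀ s : ℕ → ℝ, Summable s ∧ ∀ K t, |t| ≤ l₀ → ∀ τ ∈ T K \ Bad K t, |L.cO'' K t τ - c₀ K| ≤ vol * s K
  rate_gt : max ω θc < L.θ'
  θ₅_le : θ₅ ≤ L.θ'
  θ₃_le : θ₃ ≤ L.θ'
  rate_lt_one : L.θ' < 1
  rate_le_base : L.θ' ≤ L.Λg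
  one_le_base : 1 ≤ L.Λg

/-! ## §3 The N19 edge FROM the synchronised ledger predicate and the in-edges (node U2's OUTPUT letter) -/

section Edge

variable {C : Carriers} [DecidableEq C.Dom] {F : Type*} {ι X : Type} [MeasurableSpace ι] {σ : Type*} [DecidableEq σ]
  {L : LedgerDataSync C F ι σ} {l₀ vol : ℝ} {T : ℕ → Finset σ} {Bad : ℕ → ℝ → Finset σ} {A B : ℕ → ℝ → σ → ℝ}
  {R : Readings ι X} {W : Set (ℕ → ℝ)} {EA : Functional C C.BgA} {EB : Functional C C.BgB}
  {κ θ₅ C₅ C₉ ω θc Cd γ C₃ θ₃ Pg : ℝ} {q : ℕ} {Λm : ℕ → ℕ → ℝ} {CU : (ℕ → ℝ) → ℕ → ℝ}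
  {g : ℕ → ℕ → ℝ} {uA : ℕ → ι → C.BgA} {uB : ℕ → ι → C.BgB}

/-- **THE N19 EDGE FROM THE SYNCHRONISED «Link S R»** (node U2's OUTPUT letter): `LedgerAtSync` + the in-edges BY NAME — N16 =
`NE3Shape R C₃ θ₃` (BOTH conjuncts consumed) with the liaison `GaugeDominated`, N18 = `NE5`, N22 = `NE9 ∧ FadingMemory`, N17 through
node U2's OUTPUT `InjectedRate Cd 0 θc disc` on the printed box, the printed-grade bracket (T) `LipBackground` + `PolyLipGrowth`, both
runs' re-indexed couplings in the window — ⇒ `∃ δ, Spine.NE7.Core l₀ vol T Bad A B δ ∧ Summable δ`.  ONE line over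
`N19OtherKindsU5b.core_summable_of_nodes_u5b` (p413531); hazard H-U5b-1 is NOT a hypothesis anywhere on this road.  CONDITIONAL on
every binder; NOT NE7. [folklore] -/
theorem core_summable_of_ledgerAtSync (hL : LedgerAtSync L l₀ vol T Bad A B R EA EB κ g uA uB ω θc θ₅ θ₃)
    (h16 : NE3Shape R C₃ θ₃) (hC₃ : 0 ≤ C₃) (hgd : GaugeDominated R uA uB)
    (h18 : NE5 EA EB W κ θ₅ C₅) (hθ₅ : 0 ≤ θ₅) (hC₅ : 0 ≤ C₅)
    (h22 : NE9 EA W κ Λm ∧ T4OutputRate.FadingMemory C₉ ω Λm) (hω : 0 ≤ ω)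
    (hinj : InjectedRate Cd 0 θc (fun K j => T4CouplingMatching.disc (g K) (g (K + 1)) j)) (hCd : 0 ≤ Cd)
    (hθc : 0 ≤ θc) (hbox : ∀ K i, i ≤ K → 0 < g K i ∧ g K i ≤ γ)
    (hU : LipBackground EA W κ CU) (hG : PolyLipGrowth CU g Pg q) (hPg : 0 ≤ Pg)
    (hgA : ∀ K, g K ∈ W) (hgB : ∀ K, (fun i => g (K + 1) (i + 1)) ∈ W) :
    ∃ δ : ℕ → ℝ, NE7.Core l₀ vol T Bad A B δ ∧ Summable δ :=
  core_summable_of_nodes_u5b h16 hC₃ hgd h18 hθ₅ hC₅ h22 hω hinj hCd hθc hbox hU hG hPg hgA hgB hL.rate_gt hL.θ₅_le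
    hL.θ₃_le hL.rate_lt_one hL.rate_le_base hL.one_le_base hL.fmtA hL.fmtB hL.int hL.off hL.all_sub hL.all_sc hL.all_mult
    hL.Cl_nonneg hL.recent hL.ofmtA hL.ofmtB hL.u5b hL.CO_nonneg hL.wO_nonneg hL.orec hL.omult hL.cf_le hL.Cs_nonneg hL.posO
    hL.rvol hL.size hL.vol_nonneg hL.E₀_nonneg hL.a_pos hL.a_lt_one hL.sizeProfile hL.other hL.RO_le hL.rO_summable hL.one
    hL.cO_dev

end Edge

/-! ## §4 Non-vacuity: the synchronised ledger predicate is INHABITED (toy data), and the edge fires on it -/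

section Sanity

/-- **`LedgerAtSync` IS INHABITED** (A5-type witness for the predicate, no physics): on the tree's toy carriers (`toyCarriers`: domains =
scales, identity transport) with the toy functionals `toyEA q q` ∕ `toyEB q q C₅`, constant couplings `γ`, NE3's one-point reading family
(zero action readings), the ledger data — E-ledger `range K` STRICTLY inside the reference ledger `range (K+1)` (the top domain `K` is
EXCLUDED and RECENT, so the booking is exercised), one recent boundary piece `{K}` with factors `e^{−q^K}` ∕ `e^{−q^{K+1}}`, remaining kinds
`e^{−Σ E(·;0)}`, zero-centred sizes `(1−q)q^{K+j}`, `Cw = E₀ = Λg = CO = 1`, `a = q`, `Cl = Cs = m = 0`, common rate `(1+q)∕2` — satisfy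
EVERY field of `LedgerAtSync` at `l₀ = vol = 1`, all classes good, rate letters `ω = θc = θ₅ = θ₃ = q`. [folklore] -/
theorem ledgerAtSync_toy {q γ C₅ : ℝ} (hq0 : 0 < q) (hq1 : q < 1) :
    LedgerAtSync (C := toyCarriers) (X := Unit)
      ({ μ := fun _ _ _ => Measure.dirac ()
         fac := fun K _ _ => range K
         All := fun K => range (K + 1)
         oneA := (0 : ℝ)
         oneB := (0 : ℝ)
         oA := fun K _ _ _ => Real.exp (∑ X ∈ range K, toyEA q q (fun _ => γ) 0 X) *
           (Real.exp (-(0 : ℝ)) *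
             ((∏ _i ∈ ({K} : Finset ℕ), Real.exp (-(q ^ K))) * Real.exp (-(∑ X ∈ range K, toyEA q q (fun _ => γ) 0 X))))
         oB := fun K _ _ _ => Real.exp (∑ X ∈ range K, toyEB q q C₅ (fun _ => γ) 0 X) *
           (Real.exp (-(0 : ℝ)) *
             ((∏ _i ∈ ({K} : Finset ℕ), Real.exp (-(q ^ (K + 1)))) *
               Real.exp (-(∑ X ∈ range K, toyEB q q C₅ (fun _ => γ) 0 X))))
         facO := fun K _ _ => ({K} : Finset ℕ)
         kindO := fun _ => Kind.boundary
         scO := fun i => i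
         wO := fun _ => 1
         ofA := fun K _ _ _ _ => Real.exp (-(q ^ K))
         ofB := fun K _ _ _ _ => Real.exp (-(q ^ (K + 1)))
         cf := fun _ _ _ _ => 0
         CO := 1
         Cs := 0
         oA'' := fun K _ _ _ => Real.exp (-(∑ X ∈ range K, toyEA q q (fun _ => γ) 0 X))
         oB'' := fun K _ _ _ => Real.exp (-(∑ X ∈ range K, toyEB q q C₅ (fun _ => γ) 0 X))
         cO'' := fun K _ _ => Real.log (Real.exp (-(∑ X ∈ range K, toyEB q q C₅ (fun _ => γ) 0 X)))
           - Real.log (Real.exp (-(∑ X ∈ range K, toyEA q q (fun _ => γ) 0 X)))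
         RO'' := fun _ _ _ => 0
         rO'' := fun _ => 0
         S := fun K _ _ j => (1 - q) * q ^ (K + j)
         Cw := 1, Λg := 1, E₀ := 1, m := 0, a := q, Cl := 0, θ' := (1 + q) / 2 } : LedgerDataSync toyCarriers ℕ Unit Unit)
      1 1 (fun _ => Finset.univ) (fun _ _ => ∅)
      (fun K _ _ => ∫ _v, (∏ X ∈ range K,
          Real.exp (toyEA q q (fun _ => γ) (q ^ K) X - toyEA q q (fun _ => γ) 0 X)) *
        (Real.exp (∑ X ∈ range K, toyEA q q (fun _ => γ) 0 X) *
           (Real.exp (-(0 : ℝ)) *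
             ((∏ _i ∈ ({K} : Finset ℕ), Real.exp (-(q ^ K))) * Real.exp (-(∑ X ∈ range K, toyEA q q (fun _ => γ) 0 X)))))
        ∂(Measure.dirac ()))
      (fun K _ _ => ∫ _v, (∏ X ∈ range K,
          Real.exp (toyEB q q C₅ (fun _ => γ) (q ^ (K + 1)) X - toyEB q q C₅ (fun _ => γ) 0 X)) *
        (Real.exp (∑ X ∈ range K, toyEB q q C₅ (fun _ => γ) 0 X) *
           (Real.exp (-(0 : ℝ)) *
             ((∏ _i ∈ ({K} : Finset ℕ), Real.exp (-(q ^ (K + 1)))) *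
               Real.exp (-(∑ X ∈ range K, toyEB q q C₅ (fun _ => γ) 0 X)))))
        ∂(Measure.dirac ()))
      ({ dom := Set.univ, act := fun _ _ => 0, loc := fun k _ _ => q ^ k, vol := 0, vol_nonneg := le_rfl } :
        Readings Unit Unit)
      (toyEA q q) (toyEB q q C₅) 0 (fun _ _ => γ) (fun K _ => (q ^ K : ℝ)) (fun K _ => (q ^ (K + 1) : ℝ)) q q q q where
  fmtA _ _ _ := rfl
  fmtB _ _ _ := rfl
  int _ _ _ _ _ := ⟨Integrable.of_finite, Integrable.of_finite⟩
  off _ _ _ _ _ v hv := absurd (Set.mem_univ v) hv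
  all_sub K _ _ _ _ := Finset.range_mono (Nat.le_succ K)
  all_sc K X hX := Nat.le_of_lt_succ (mem_range.mp hX)
  all_mult K j hj := by
    show ∑ i ∈ range (K + 1) with i = j, Real.exp (-(0 * (0 : ℝ))) ≤ 1 * 1 * (1 : ℝ) ^ (K - j)
    rw [Finset.filter_eq', if_pos (mem_range.mpr (Nat.lt_succ_of_le hj)), sum_singleton]
    simp
  Cl_nonneg := le_rfl
  recent K _ _ _ _ X hX := by
    have h1 : X < K + 1 := mem_range.mp (mem_sdiff.mp hX).1
    have h2 : ¬ X < K := fun h => (mem_sdiff.mp hX).2 (mem_range.mpr h)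
    have hX' : X = K := le_antisymm (Nat.lt_succ_iff.mp h1) (not_lt.mp h2)
    subst hX'
    exact ⟨jlogOf_le 0 X, le_rfl⟩
  ofmtA _ _ _ _ := rfl
  ofmtB _ _ _ _ := rfl
  u5b K t _ τ _ v _ i hi := by
    rw [mem_singleton] at hi
    subst hi
    refine ⟨Real.exp_pos _, Real.exp_pos _, ?_⟩
    show |Real.log (Real.exp (-(q ^ (i + 1)))) - Real.log (Real.exp (-(q ^ i))) - 0|
      ≤ 1 * (((1 + q) / 2) ^ i + 0) * 1
    rw [Real.log_exp, Real.log_exp]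
    have e : -(q ^ (i + 1)) - -(q ^ i) - 0 = (1 - q) * q ^ i := by ring
    rw [e, abs_of_nonneg (mul_nonneg (by linarith) (pow_nonneg hq0.le _)), one_mul, add_zero, mul_one]
    exact (mul_le_of_le_one_left (pow_nonneg hq0.le _) (by linarith)).trans
      (pow_le_pow_left₀ hq0.le (by linarith) i)
  CO_nonneg := zero_le_one
  wO_nonneg _ := zero_le_one
  orec K _ _ _ _ i hi := by
    rw [mem_singleton] at hi
    subst hi
    exact ⟨jlogOf_le 0 i, le_rfl⟩
  omult K _ _ _ _ j _ _ := by
    show ∑ i ∈ ({K} : Finset ℕ) with i = j, (1 : ℝ) ≤ 1 * 1 * (1 : ℝ) ^ (K - j)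
    rw [Finset.filter_singleton]
    split_ifs <;> simp
  cf_le _ _ _ _ _ _ _ := by simp
  Cs_nonneg := le_rfl
  posO _ _ _ _ _ _ _ := ⟨Real.exp_pos _, Real.exp_pos _⟩
  rvol := zero_le_one
  size K t _ τ _ v _ j hj := by
    show |∑ X ∈ range K with X = j,
        (Real.log (Real.exp (toyEB q q C₅ (fun _ => γ) (q ^ (K + 1)) X - toyEB q q C₅ (fun _ => γ) 0 X))
          - Real.log (Real.exp (toyEA q q (fun _ => γ) (q ^ K) X - toyEA q q (fun _ => γ) 0 X)))|
      ≤ (1 - q) * q ^ (K + j)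
    rw [Finset.filter_eq']
    by_cases hjK : j < K
    · rw [if_pos (mem_range.mpr hjK), sum_singleton, Real.log_exp, Real.log_exp]
      simp only [toyEA, toyEB]
      have e : q ^ j * q ^ (K + 1) + ∑ i ∈ range j, q ^ (j - i) * γ - C₅ * q ^ j
          - (q ^ j * 0 + ∑ i ∈ range j, q ^ (j - i) * γ - C₅ * q ^ j)
          - (q ^ j * q ^ K + ∑ i ∈ range j, q ^ (j - i) * γ - (q ^ j * 0 + ∑ i ∈ range j, q ^ (j - i) * γ))
          = -((1 - q) * q ^ (K + j)) := by ring
      rw [e, abs_neg, abs_of_nonneg (mul_nonneg (by linarith) (pow_nonneg hq0.le _))]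
    · rw [if_neg (fun h => hjK (mem_range.mp h)), sum_empty, abs_zero]
      exact mul_nonneg (by linarith) (pow_nonneg hq0.le _)
  vol_nonneg := zero_le_one
  E₀_nonneg := zero_le_one
  a_pos := hq0
  a_lt_one := hq1
  sizeProfile K t _ τ _ j hj := by
    show (1 - q) * q ^ (K + j) ≤ 1 * (1 * ((K : ℝ) + 1) ^ 0 * q ^ (K - j))
    rw [pow_zero, one_mul, one_mul, one_mul]
    exact (mul_le_of_le_one_left (pow_nonneg hq0.le _) (by linarith)).trans
      (pow_le_pow_of_le_one hq0.le hq1.le (by omega))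
  other _ _ _ _ _ _ _ := by simp
  RO_le _ _ _ _ _ := by simp
  rO_summable := summable_zero
  one := rfl
  cO_dev := ⟨fun K => Real.log (Real.exp (-(∑ X ∈ range K, toyEB q q C₅ (fun _ => γ) 0 X)))
      - Real.log (Real.exp (-(∑ X ∈ range K, toyEA q q (fun _ => γ) 0 X))), fun _ => 0, summable_zero,
    fun K t _ τ _ => by simp⟩
  rate_gt := by rw [max_self]; linarith
  θ₅_le := by linarith
  θ₃_le := by linarith
  rate_lt_one := by linarith
  rate_le_base := by show (1 + q) / 2 ≤ (1 : ℝ); linarith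
  one_le_base := le_rfl

end Sanity

end Summit.QuantumFields.YangMills.BalabanUVNodes.N19LedgerLinkSync
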